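import Literature.AlgebraicGeometry.HodgeTheory.FermatSurfaceLineFamilies
import Literature.AlgebraicGeometry.HodgeTheory.DiagonalSymmetryGysinEquivariance
import HarnessLib

/-!
# `g_a^* cl(L) = cl(a⁻¹ L)`: the diagonal symmetries of the Fermat surface permute the line classes

Family `hodge`, layer `Literature/AlgebraicGeometry/HodgeTheory`. PROOF FILE (theorems only; the
small definitions `translate`, `pair`, `lineTwist`, … are in `FermatSurfaceLineFamilies`), no named fact. For the Fermat
surface `X = X²ₘ ⊂ ℙ³_ℂ`, its lines `L(u, u') : x₀ = u x₁, x₂ = u' x₃` (`FermatSurfaceLines`: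
`FermatSurface.lineEmb`, `FermatSurface.lineClass`) and the diagonal symmetries
`g_a : [x] ↦ [a • x]`, `a ∈ μₘ⁴` (`diagonalAut`, `diagonalMap`; Shioda, Math. Ann. 245 (1979) §1;
Ran, Compositio Math. 42 (1980) §1), the group permutes the lines, `a · L(u, u') = L(u a₀/a₁, u' a₂/a₃)`,
and for the COMPLEX orientation family the classes follow:

* `FermatSurface.mapContinuous_lineEmb_comp_diagonalAut` — on complex points,
  `g_{a⁻¹} ∘ g_{L(w)} = g_{L(translate a w)} ∘ t_a` with `t_a = [y₀ : y₁] ↦ [a₁⁻¹ y₀ : a₃⁻¹ y₁]` the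
  reparametrisation of `ℙ¹` (coordinates `[u y₀ : y₀ : u' y₁ : y₁]`);
* `FermatSurface.map_diagonalMap_lineClass` — **`g_a^* cl(L(w)) = cl(L(translate a w))`** in
  `H²(X(ℂ); ℂ)` for `complexOrientationFamily`: pull-back along the automorphism `g_a` is push-forward
  along `g_{a⁻¹}` (`complexBetti_map_complexGysin_of_comp_eq_id`, degree `+1` of isomorphisms for the
  complex orientations, Fulton Lemma 19.1.2), the Gysin morphism only sees the continuous map, and the
  reparametrisation `t_a` (an automorphism of `ℙ¹`) does not change the class
  (`complexGysin_comp_one_of_isBirational`).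

(The general equivariance `g_a^*(φ_* y) = (φ ≫ g_{a⁻¹})_* y` is `map_diagonalMap_complexGysin` of
`DiagonalSymmetryGysinEquivariance`.)

## References

* [Shioda1979HodgeFermat] T. Shioda, The Hodge conjecture for Fermat varieties, Math. Ann. 245 (1979), §1.
* [Ran1980] Z. Ran, Cycles on Fermat hypersurfaces, Compositio Math. 42 (1980), §1 (1.1)–(1.3).
* [Fulton1998] W. Fulton, Intersection Theory, 2nd ed. 1998, §1.4, Lemma 19.1.2.
* [FultonYoungTableaux1997] W. Fulton, Young Tableaux, App. B §B.1 (2), (5).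
* [Hartshorne1977] R. Hartshorne, Algebraic Geometry (1977), II Example 7.1.1.
-/

noncomputable section

open scoped LinearAlgebra.Projectivization
open CategoryTheory AlgebraicGeometry MvPolynomial
open Literature.AlgebraicGeometry.Motives Literature.AlgebraicTopology.SingularHomology
open Literature.NumberTheory.Transcendental

namespace Literature.AlgebraicGeometry.HodgeTheory

namespace FermatSurface

variable {m : ℕ}

/-! ### The reparametrisation `t_a` of `ℙ¹` and the point-wise identity -/

/-- **`a⁻¹ • (u y₀, y₀, u' y₁, y₁)` is the point of parameter `t_a(y)` on `L(translate a w)`.**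
[cite: Shioda1979HodgeFermat, §1] -/
theorem inv_smul_lineVec (a : Fin (2 * 1 + 2) → ℂˣ) (w : Fin 2 → ℂ) (y : Fin (1 + 1) → ℂ) :
    a⁻¹ • lineVec w y = lineVec (translate a w) (lineTwist a • y) := by
  have e0 : (a⁻¹ • lineVec w y) 0 = lineVec (translate a w) (lineTwist a • y) 0 := by
    simp [lineVec, lineTwist, Pi.smul_apply', Units.smul_def]
    field_simp
  have e1 : (a⁻¹ • lineVec w y) 1 = lineVec (translate a w) (lineTwist a • y) 1 := by
    simp [lineVec, lineTwist, Pi.smul_apply', Units.smul_def]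
  have e2 : (a⁻¹ • lineVec w y) 2 = lineVec (translate a w) (lineTwist a • y) 2 := by
    simp [lineVec, lineTwist, Pi.smul_apply', Units.smul_def]
    field_simp
  have e3 : (a⁻¹ • lineVec w y) 3 = lineVec (translate a w) (lineTwist a • y) 3 := by
    simp [lineVec, lineTwist, Pi.smul_apply', Units.smul_def]
  exact _root_.funext (forall_fin_four
    (P := fun i ↦ (a⁻¹ • lineVec w y) i = lineVec (translate a w) (lineTwist a • y) i) e0 e1 e2 e3)

/-- **`g_{a⁻¹} ∘ g_{L(w)} = g_{L(translate a w)} ∘ t_a` on complex points** (`a ∈ μₘ⁴`): both send the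
point of parameter `[y]` to the point of coordinates `[a⁻¹ • (u y₀, y₀, u' y₁, y₁)]`.
[cite: Shioda1979HodgeFermat, §1] -/
theorem mapContinuous_lineEmb_comp_diagonalAut {a : Fin (2 * 1 + 2) → ℂˣ}
    (ha : a ∈ fermatGroup (2 * 1) m) (w : Fin 2 → ℂ) (hw : ∀ q, w q ^ m = -1) :
    AlgPoints.mapContinuous (L := ℂ)
        (lineEmb m w hw ≫ diagonalAut (fermatPolynomial ℂ (2 * 1) m)
          (inv_mem (fermatGroup_le_diagonalStabilizer m ha))) =
      AlgPoints.mapContinuous (L := ℂ)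
        (diagonalProjMap (n := 0) (lineTwist a) ≫ lineEmb m (translate a w) (translate_pow ha hw)) := by
  refine ContinuousMap.ext fun P ↦ ?_
  obtain ⟨p, rfl⟩ := projPoint_surjective 1 P
  induction p using Projectivization.ind with
  | h y hy =>
  change AlgPoints.map _ (projPoint 1 (Projectivization.mk ℂ y hy)) =
    AlgPoints.map _ (projPoint 1 (Projectivization.mk ℂ y hy))
  rw [AlgPoints.map_comp_apply, AlgPoints.map_comp_apply]
  apply (isEmbedding_hypersurfacePoint (SmoothHypersurface.hypersurfaceι (fermatPolynomial ℂ (2 * 1) m))).injective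
  have hL : hypersurfacePoint (SmoothHypersurface.hypersurfaceι (fermatPolynomial ℂ (2 * 1) m))
      (AlgPoints.map (diagonalAut (fermatPolynomial ℂ (2 * 1) m)
        (inv_mem (fermatGroup_le_diagonalStabilizer m ha)))
        (AlgPoints.map (lineEmb m w hw) (projPoint 1 (Projectivization.mk ℂ y hy)))) =
      Projectivization.mk ℂ (a⁻¹ • lineVec w y) ((smul_ne_zero_iff_ne a⁻¹).mpr (lineVec_ne_zero w hy)) := by
    rw [← diagonalMap_apply, hypersurfacePoint_diagonalMap, Projectivization.mk_eq_mk_iff']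
    obtain ⟨c, hc⟩ := Projectivization.exists_smul_eq_mk_rep ℂ (lineVec w y) (lineVec_ne_zero w hy)
    refine ⟨c, ?_⟩
    rw [hypersurfacePoint_map_lineEmb, ← hc, smul_comm]
    rfl
  have hR : hypersurfacePoint (SmoothHypersurface.hypersurfaceι (fermatPolynomial ℂ (2 * 1) m))
      (AlgPoints.map (lineEmb m (translate a w) (translate_pow ha hw))
        (AlgPoints.map (diagonalProjMap (n := 0) (lineTwist a)) (projPoint 1 (Projectivization.mk ℂ y hy)))) =
      Projectivization.mk ℂ (lineVec (translate a w) (lineTwist a • y))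
        (lineVec_ne_zero _ ((smul_ne_zero_iff_ne _).mpr hy)) := by
    have h1 : AlgPoints.map (diagonalProjMap (n := 0) (lineTwist a)) (projPoint 1 (Projectivization.mk ℂ y hy)) =
        projPoint 1 (Projectivization.mk ℂ (lineTwist a • y) ((smul_ne_zero_iff_ne _).mpr hy)) :=
      map_diagonalProjMap_projPoint (n := 0) (lineTwist a) y hy
    rw [h1, hypersurfacePoint_map_lineEmb]
  rw [hL, hR]
  exact (Projectivization.mk_eq_mk_iff' ℂ _ _ _ _).mpr ⟨1, by rw [one_smul, inv_smul_lineVec]⟩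

/-! ### `g_a^* cl(L(w)) = cl(L(translate a w))` -/

/-- **The diagonal symmetries permute the line classes: `g_a^* cl(L(w)) = cl(L(translate a w))`**
in `H²(X²ₘ(ℂ); ℂ)`, for the complex orientation family (`a ∈ μₘ⁴`, `m ≥ 1`). Proof: `g_a` is an
automorphism with inverse `g_{a⁻¹}`, so `g_a^*(φ_* 1) = (φ ≫ g_{a⁻¹})_* 1`
(`complexBetti_map_complexGysin_of_comp_eq_id`, degree `+1` of isomorphisms for the complex
orientations); `φ ≫ g_{a⁻¹}` and `t_a ≫ φ'` (`φ' = g_{L(translate a w)}`) agree on complex points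
(`mapContinuous_lineEmb_comp_diagonalAut`), and `(t_a ≫ φ')_* 1 = φ'_* 1`
(`complexGysin_comp_one_of_isBirational`). This is "`g^* [L] = [g⁻¹ L]`".
[cite: Shioda1979HodgeFermat, §1] [cite: Ran1980, §1 (1.1)–(1.3)] [cite: Fulton1998, Lemma 19.1.2 and §1.4] -/
theorem map_diagonalMap_lineClass (hm : 1 ≤ m) {a : Fin (2 * 1 + 2) → ℂˣ}
    (ha : a ∈ fermatGroup (2 * 1) m) (w : Fin 2 → ℂ) (hw : ∀ q, w q ^ m = -1) :
    singularCohomology.map ℂ ℂ (diagonalMap (fermatPolynomial ℂ (2 * 1) m)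
        (fermatGroup_le_diagonalStabilizer m ha)) (2 * 1) (lineClass complexOrientationFamily m w hw hm) =
      lineClass complexOrientationFamily m (translate a w) (translate_pow ha hw) hm := by
  have ha' := fermatGroup_le_diagonalStabilizer m ha
  rw [lineClass, map_diagonalMap_complexGysin _ (isSmoothProjective_X hm) ha'
    (isSmoothProjective_projectiveSpace' 1) (lineEmb m w hw),
    complexGysin_congr_mapContinuous complexOrientationFamily (isSmoothProjective_projectiveSpace' 1)
      (isSmoothProjective_X hm) (mapContinuous_lineEmb_comp_diagonalAut ha w hw),
    complexGysin_comp_one_of_isBirational (isSmoothProjective_projectiveSpace' 1)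
      (isSmoothProjective_projectiveSpace' 1) (isSmoothProjective_X hm) (diagonalProjMap (n := 0) (lineTwist a))
      (isBirational_diagonalProjMap_left _) (lineEmb m (translate a w) (translate_pow ha hw))]
  rfl

end FermatSurface

end Literature.AlgebraicGeometry.HodgeTheory

end
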